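import Summits.QuantumFields.BalabanUV.Beta.SpineRootedBmN
import Literature.MathematicalPhysics.QuantumFieldTheory.Balaban1983to89.Beta.KernelWard

/-!
# The `hW` (Ward) END for the co-dressed native spine `JsBalBm♮_ρ`, kernel-level sockets

Companion of `SpineRootedBmNReduced` (the `hR` END).  The END grade of row D1,
`OneStepKernelFamily.d1Drift_of_D1Tel_D1Rep`, takes besides `hR` the WARD binder
`hW : ∀ j, WardTransversal (flipK (TbalOf Lc Js j))` for the same one-step family `Js`.  For the
Π_bm-co-dressed rooted family `Js = SpineRooted.JsBalBmNAtOf …` (`= dressBmAt ρ ∘ JsBal⁰♮_ρ`) every member's kernel is,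
BY `AxialDressingRooted.TbalOf_dressBmAt`, the resolvent Hessian kernel
`hessKer G_j (vertexOfK G_j Lc S_j) W_j` of the co-dressed step covariance
`G_j := coDressKBmAt ρ Lc (KInvStep Lc j)` with the UNDRESSED tables `S_j := (JsBal⁰♮_ρ j).S`, `W_j := (JsBal⁰♮_ρ j).W = W j`.
`KernelWard.wardTransversal_flip_hessKer` proves the Ward law of such a kernel from the two KERNEL-LEVEL Ward laws of the
vertices — (W1) `G·(div V)·G = [G, X]`, (W2) `div W = [X, V]` for one bi-localised block family `X` — plus decay / localisation /
block covariance, all of which are THEOREMS for this family.  This file wires exactly that: the conclusion is literally the `hW`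
binder for `JsBalBmNAtOf`, the hypotheses are (W1)/(W2) per step `j` and the localisation of `X j`; nothing is discharged beyond
the structural side conditions (decay of `G_j`, localisation of the chain-rule vertex, block covariance from (St)/(Wt)).

Contents: `wardTransversal_flipK_hessKer_of_loc` (rate-matching form of `KernelWard.wardTransversal_flip_hessKer`),
`wardTransversal_flipK_TbalOf_dressBmAt` (any undressed spine, any in-block root), and the two named roots
`wardTransversal_flipK_TbalOf_JsBalBmNAtOf_kernel` (any root) / `…_ctrC_kernel` (centred root, odd `Lc` — the family term of the
`hR` root `axisReflectionCovariant_flipK_TbalOf_JsBalBmNAtOf_ctrC_candidate`).  All statements are [folklore] wiring.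
-/

open Finset
open scoped BigOperators
open Literature.MathematicalPhysics.QuantumFieldTheory
open Literature.MathematicalPhysics.QuantumFieldTheory.Balaban1983to89
open Literature.MathematicalPhysics.QuantumFieldTheory.Balaban1983to89.Beta
open ExpKernelCalculus (MKer Decays BiLoc comp hessKer VertexFamily VertexFamily₂ BlockCovariant shiftK)
open AffineAveraging (box toSite)
open AveragingContoursRooted (ctrOff ctrOff_mem_box)
open PolarizationSign (WardTransversal)
open KernelWard (divV divW wardTransversal_flip_hessKer)
open OneStepResolventKernel (Fib LocStencil JetData decays_mono biLoc_mono)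
open OneStepKernelFamily (KInvStep vertexOfK vertexFamily_vertexOfK' TbalOf flipK)
open ResolventReflection (vertexOfK_translate_block)
open BalabanStepJets (vertexFamily₂_mono)
open Summit.QuantumFields.BalabanUV.Beta.TameKernelCalculus
open Summit.QuantumFields.BalabanUV.Beta.AxialDressingRooted (dressBmAt coDressKBmAt TbalOf_dressBmAt decays_coDressKBmAt_KInvStep
  shiftK_coDressKBmAt_KInvStep one_le_of_neZero)

noncomputable section

namespace Summit.QuantumFields.BalabanUV.Beta.SpineRooted

variable {d : ℕ}

/-! ## §1 Rate matching -/

section Rates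

/-- [folklore] **`KernelWard.wardTransversal_flip_hessKer` WITH INDEPENDENT RATES.**  The kernel Ward lemma asks for ONE common
localisation rate of `A`, `V`, `W`, `X`; given the four bounds at their own rates, restrict all of them to the minimum. Conclusion
phrased with `flipK` (`flipK T μ ν z = T μ ν (−z)` by `rfl`). -/
theorem wardTransversal_flipK_hessKer_of_loc {A : MKer (d + 1) (Fib d)}
    {V : Fin (d + 1) → (Fin (d + 1) → ℤ) → MKer (d + 1) (Fib d)}
    {W : Fin (d + 1) → (Fin (d + 1) → ℤ) → Fin (d + 1) → (Fin (d + 1) → ℤ) → MKer (d + 1) (Fib d)} {N : ℕ}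
    (hA : ∃ δ C : ℝ, 0 < δ ∧ 0 ≤ C ∧ Decays A C δ) (hV : ∃ Cv δv : ℝ, 0 < δv ∧ VertexFamily V N Cv δv)
    (hW : ∃ Cw δ : ℝ, 0 < δ ∧ VertexFamily₂ W N Cw δ)
    (X : (Fin (d + 1) → ℤ) → MKer (d + 1) (Fib d))
    (hX : ∃ Cx δx : ℝ, 0 < δx ∧ ∀ y, BiLoc (X y) ((N : ℤ) • y) ((N : ℤ) • y) Cx δx)
    (hcov : BlockCovariant A V W N)
    (hW1 : ∀ y, comp (comp A (divV V y)) A = comp A (X y) - comp (X y) A)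
    (hW2 : ∀ y ν y', divW W y ν y' = comp (X y) (V ν y') - comp (V ν y') (X y)) :
    WardTransversal (flipK (hessKer A V W)) := by
  obtain ⟨δA, C, hδA, hC, hA⟩ := hA
  obtain ⟨Cv, δv, hδv, hV⟩ := hV
  obtain ⟨Cw, δW, hδW, hW⟩ := hW
  obtain ⟨Cx, δx, hδx, hX⟩ := hX
  set δ0 : ℝ := min (min δA δv) (min δW δx) with hδ0
  have hδ0p : 0 < δ0 := lt_min (lt_min hδA hδv) (lt_min hδW hδx)
  have h1 : δ0 ≤ δA := (min_le_left _ _).trans (min_le_left _ _)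
  have h2 : δ0 ≤ δv := (min_le_left _ _).trans (min_le_right _ _)
  have h3 : δ0 ≤ δW := (min_le_right _ _).trans (min_le_left _ _)
  have h4 : δ0 ≤ δx := (min_le_right _ _).trans (min_le_right _ _)
  have hCv : 0 ≤ Cv := (hV 0 0).nonneg (Sum.inl 0)
  have hCw : 0 ≤ Cw := (hW 0 0 0 0).nonneg (Sum.inl 0)
  have hCx : 0 ≤ Cx := (hX 0).nonneg (Sum.inl 0)
  have hA' : Decays A C δ0 := decays_mono hA hC le_rfl h1
  have hV' : VertexFamily V N Cv δ0 := fun μ y => biLoc_mono (hV μ y) hCv h2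
  have hW' : VertexFamily₂ W N Cw δ0 := vertexFamily₂_mono hW hCw h3
  have hX' : ∀ y, BiLoc (X y) ((N : ℤ) • y) ((N : ℤ) • y) Cx δ0 := fun y => biLoc_mono (hX y) hCx h4
  exact wardTransversal_flip_hessKer X hA' hV' hW' hX' hδ0p hcov hW1 hW2

end Rates

/-! ## §2 The Ward END for a co-dressed spine (dimension four) -/

section Dressed

/-- [folklore] **THE `hW` BINDER FOR A Π_bm-CO-DRESSED FAMILY, OVER THE KERNEL-LEVEL WARD SOCKETS.**  Let `Js⁰ : ℕ → JetData 3 Lc`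
be undressed step jets satisfying (St)/(Wt) (block-translation covariance of both tables) and `r` an in-block root; put
`G_j := coDressKBmAt (toSite r) Lc (KInvStep Lc j)` and `V_j := vertexOfK G_j Lc (Js⁰ j).S`.  If for every `j` some bi-localised block
family `X j` satisfies (W1) `G_j·(divV V_j y)·G_j = G_j·X j y − X j y·G_j` and (W2) `divW (Js⁰ j).W y ν y' = X j y·V_j ν y' − V_j ν y'·X j y`,
then every member of `fun j ↦ dressBmAt hr (Js⁰ j)` has a Ward-transversal (flipped) kernel. -/
theorem wardTransversal_flipK_TbalOf_dressBmAt {Lc : ℕ} [NeZero Lc] {r : Fin 4 → ℕ} (hr : r ∈ box 4 Lc) (Js : ℕ → JetData 3 Lc)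
    (hSt : ∀ (j : ℕ) (κ' : Fin 4) (u t : Fin 4 → ℤ), (Js j).S κ' (u + (Lc : ℤ) • t) = shiftK (-((Lc : ℤ) • t)) ((Js j).S κ' u))
    (hWt : ∀ (j : ℕ) (μ : Fin 4) (y : Fin 4 → ℤ) (ν : Fin 4) (y' t : Fin 4 → ℤ),
      (Js j).W μ (y + t) ν (y' + t) = shiftK (-((Lc : ℤ) • t)) ((Js j).W μ y ν y'))
    (X : ℕ → (Fin 4 → ℤ) → MKer 4 (Fib 3))
    (hX : ∀ j, ∃ Cx δx : ℝ, 0 < δx ∧ ∀ y, BiLoc (X j y) ((Lc : ℤ) • y) ((Lc : ℤ) • y) Cx δx)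
    (hW1 : ∀ j y, comp (comp (coDressKBmAt (toSite r) Lc (KInvStep (d := 3) Lc j))
        (divV (vertexOfK (coDressKBmAt (toSite r) Lc (KInvStep (d := 3) Lc j)) Lc (Js j).S) y))
        (coDressKBmAt (toSite r) Lc (KInvStep (d := 3) Lc j))
      = comp (coDressKBmAt (toSite r) Lc (KInvStep (d := 3) Lc j)) (X j y)
        - comp (X j y) (coDressKBmAt (toSite r) Lc (KInvStep (d := 3) Lc j)))
    (hW2 : ∀ j y ν y', divW (Js j).W y ν y'
      = comp (X j y) (vertexOfK (coDressKBmAt (toSite r) Lc (KInvStep (d := 3) Lc j)) Lc (Js j).S ν y')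
        - comp (vertexOfK (coDressKBmAt (toSite r) Lc (KInvStep (d := 3) Lc j)) Lc (Js j).S ν y') (X j y)) :
    ∀ j : ℕ, WardTransversal (flipK (TbalOf Lc (fun j => dressBmAt hr (Js j)) j)) := by
  intro j
  rw [TbalOf_dressBmAt hr Js j]
  have hKd := decays_coDressKBmAt_KInvStep (d := 3) hr j
  have hKs : ∀ t, shiftK (-((Lc : ℤ) • t)) (coDressKBmAt (toSite r) Lc (KInvStep (d := 3) Lc j))
      = coDressKBmAt (toSite r) Lc (KInvStep (d := 3) Lc j) := fun t => shiftK_coDressKBmAt_KInvStep (d := 3) (toSite r) j t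
  have hcov : BlockCovariant (coDressKBmAt (toSite r) Lc (KInvStep (d := 3) Lc j))
      (vertexOfK (coDressKBmAt (toSite r) Lc (KInvStep (d := 3) Lc j)) Lc (Js j).S) (Js j).W Lc :=
    ⟨hKs, vertexOfK_translate_block hKs (hSt j), hWt j⟩
  exact wardTransversal_flipK_hessKer_of_loc hKd (vertexFamily_vertexOfK' (N := Lc) hKd (Js j).loc (Js j).δ_pos)
    ⟨(Js j).Cw, (Js j).δ, (Js j).δ_pos, (Js j).loc₂⟩ (X j) (hX j) hcov (hW1 j) (hW2 j)

end Dressed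

/-! ## §3 The named roots for `JsBalBm♮_ρ` -/

section Roots

variable {Lc : ℕ} [NeZero Lc] (cE cVH cΛ : ℝ)
    (W : ℕ → Fin 4 → (Fin 4 → ℤ) → Fin 4 → (Fin 4 → ℤ) → ExpKernelCalculus.MKer 4 (Fib 3))
    (Cw δw : ℕ → ℝ) (hδw : ∀ j, 0 < δw j) (hW : ∀ j, VertexFamily₂ (W j) Lc (Cw j) (δw j))

/-- [folklore] **THE `hW` ROOT FOR `JsBalBm♮_ρ`, ANY IN-BLOCK ROOT, KERNEL-LEVEL SOCKETS.**  With
`G_j := coDressKBmAt (toSite r) Lc (KInvStep Lc j)`, `S_j := (JsBal0NAtOf … j).S` (the native undressed first-order tables) and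
`V_j := vertexOfK G_j Lc S_j`: the kernel Ward laws (W1)/(W2) of every step against one bi-localised block family `X j` give
`∀ j, WardTransversal (flipK (TbalOf Lc (JsBalBmNAtOf …) j))` — the `hW` binder of `OneStepKernelFamily.d1Drift_of_D1Tel_D1Rep` for
this family.  (St) is the theorem `JsBal0NAtOf_S_translate`; (Wt) is the hypothesis `hWt` on the supplied tables. -/
theorem wardTransversal_flipK_TbalOf_JsBalBmNAtOf_kernel (hLc : 1 ≤ Lc) {r : Fin 4 → ℕ} (hr : r ∈ box 4 Lc)
    (hWt : ∀ (j : ℕ) (μ : Fin 4) (y : Fin 4 → ℤ) (ν : Fin 4) (y' t : Fin 4 → ℤ),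
      W j μ (y + t) ν (y' + t) = shiftK (-((Lc : ℤ) • t)) (W j μ y ν y'))
    (X : ℕ → (Fin 4 → ℤ) → MKer 4 (Fib 3))
    (hX : ∀ j, ∃ Cx δx : ℝ, 0 < δx ∧ ∀ y, BiLoc (X j y) ((Lc : ℤ) • y) ((Lc : ℤ) • y) Cx δx)
    (hW1 : ∀ j y, comp (comp (coDressKBmAt (toSite r) Lc (KInvStep (d := 3) Lc j))
        (divV (vertexOfK (coDressKBmAt (toSite r) Lc (KInvStep (d := 3) Lc j)) Lc
          (JsBal0NAtOf hLc hr cE cVH cΛ W Cw δw hδw hW j).S) y))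
        (coDressKBmAt (toSite r) Lc (KInvStep (d := 3) Lc j))
      = comp (coDressKBmAt (toSite r) Lc (KInvStep (d := 3) Lc j)) (X j y)
        - comp (X j y) (coDressKBmAt (toSite r) Lc (KInvStep (d := 3) Lc j)))
    (hW2 : ∀ j y ν y', divW (W j) y ν y'
      = comp (X j y) (vertexOfK (coDressKBmAt (toSite r) Lc (KInvStep (d := 3) Lc j)) Lc
          (JsBal0NAtOf hLc hr cE cVH cΛ W Cw δw hδw hW j).S ν y')
        - comp (vertexOfK (coDressKBmAt (toSite r) Lc (KInvStep (d := 3) Lc j)) Lc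
          (JsBal0NAtOf hLc hr cE cVH cΛ W Cw δw hδw hW j).S ν y') (X j y)) :
    ∀ j : ℕ, WardTransversal (flipK (TbalOf Lc (JsBalBmNAtOf (d := 3) hLc hr cE cVH cΛ W Cw δw hδw hW) j)) := by
  have hW2' : ∀ j y ν y', divW (JsBal0NAtOf hLc hr cE cVH cΛ W Cw δw hδw hW j).W y ν y'
      = comp (X j y) (vertexOfK (coDressKBmAt (toSite r) Lc (KInvStep (d := 3) Lc j)) Lc
          (JsBal0NAtOf hLc hr cE cVH cΛ W Cw δw hδw hW j).S ν y')
        - comp (vertexOfK (coDressKBmAt (toSite r) Lc (KInvStep (d := 3) Lc j)) Lc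
          (JsBal0NAtOf hLc hr cE cVH cΛ W Cw δw hδw hW j).S ν y') (X j y) := by
    intro j y ν y'
    rw [JsBal0NAtOf_W]
    exact hW2 j y ν y'
  exact wardTransversal_flipK_TbalOf_dressBmAt hr (JsBal0NAtOf hLc hr cE cVH cΛ W Cw δw hδw hW)
    (JsBal0NAtOf_S_translate hLc hr cE cVH cΛ W Cw δw hδw hW)
    (JsBal0NAtOf_W_translate hLc hr cE cVH cΛ W Cw δw hδw hW hWt) X hX hW1 hW2'

/-- [folklore] **THE `hW` ROOT AT THE CENTRED ROOT, ODD `Lc`** — the same family term as the `hR` root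
`axisReflectionCovariant_flipK_TbalOf_JsBalBmNAtOf_ctrC_candidate` (`SpineRootedBmNReduced`), so that the two binders of
`OneStepKernelFamily.d1Drift_of_D1Tel_D1Rep` speak about one and the same `Js`. -/
theorem wardTransversal_flipK_TbalOf_JsBalBmNAtOf_ctrC_kernel (hLc : Odd Lc)
    (hWt : ∀ (j : ℕ) (μ : Fin 4) (y : Fin 4 → ℤ) (ν : Fin 4) (y' t : Fin 4 → ℤ),
      W j μ (y + t) ν (y' + t) = shiftK (-((Lc : ℤ) • t)) (W j μ y ν y'))
    (X : ℕ → (Fin 4 → ℤ) → MKer 4 (Fib 3))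
    (hX : ∀ j, ∃ Cx δx : ℝ, 0 < δx ∧ ∀ y, BiLoc (X j y) ((Lc : ℤ) • y) ((Lc : ℤ) • y) Cx δx)
    (hW1 : ∀ j y, comp (comp (coDressKBmAt (toSite (ctrOff 4 Lc)) Lc (KInvStep (d := 3) Lc j))
        (divV (vertexOfK (coDressKBmAt (toSite (ctrOff 4 Lc)) Lc (KInvStep (d := 3) Lc j)) Lc
          (JsBal0NAtOf hLc.pos (ctrOff_mem_box hLc.pos) cE cVH cΛ W Cw δw hδw hW j).S) y))
        (coDressKBmAt (toSite (ctrOff 4 Lc)) Lc (KInvStep (d := 3) Lc j))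
      = comp (coDressKBmAt (toSite (ctrOff 4 Lc)) Lc (KInvStep (d := 3) Lc j)) (X j y)
        - comp (X j y) (coDressKBmAt (toSite (ctrOff 4 Lc)) Lc (KInvStep (d := 3) Lc j)))
    (hW2 : ∀ j y ν y', divW (W j) y ν y'
      = comp (X j y) (vertexOfK (coDressKBmAt (toSite (ctrOff 4 Lc)) Lc (KInvStep (d := 3) Lc j)) Lc
          (JsBal0NAtOf hLc.pos (ctrOff_mem_box hLc.pos) cE cVH cΛ W Cw δw hδw hW j).S ν y')
        - comp (vertexOfK (coDressKBmAt (toSite (ctrOff 4 Lc)) Lc (KInvStep (d := 3) Lc j)) Lc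
          (JsBal0NAtOf hLc.pos (ctrOff_mem_box hLc.pos) cE cVH cΛ W Cw δw hδw hW j).S ν y') (X j y)) :
    ∀ j : ℕ, WardTransversal (flipK (TbalOf Lc
      (JsBalBmNAtOf (d := 3) hLc.pos (ctrOff_mem_box hLc.pos) cE cVH cΛ W Cw δw hδw hW) j)) :=
  wardTransversal_flipK_TbalOf_JsBalBmNAtOf_kernel cE cVH cΛ W Cw δw hδw hW hLc.pos (ctrOff_mem_box hLc.pos) hWt X hX hW1 hW2

end Roots

end Summit.QuantumFields.BalabanUV.Beta.SpineRooted

end
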